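import Summits.QuantumFields.YangMills.Theorems.UnitScaleTiltProp7NestedMeanTowerCloseness
import Summits.QuantumFields.YangMills.Theorems.UnitScaleTiltProp7NSIntertwinerOfRecord
import Summits.QuantumFields.YangMills.Theorems.UnitScaleTiltProp7BlockMeanContraction
import HarnessLib

/-!
# Route `UnitScaleTilt`, crux K1 «MinimiserStabilityRegPr» (stmt-QuantumFields-19200), EX row `hGF[Lift]` (curved member) — **LOD LINE, PEN (L5″) FILE 2g-member-Q:
# THE TOP NESTED COVARIANT MEAN OF RECORD IS GAUGE COVARIANT** — if two backgrounds are related by a gauge transformation read in units, `U₁♭ = (U₀♭)^{w}`, then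
# for EVERY averaging-of-record map `Q″₀` at `U₀` and `Q″₁` at `U₁` (the `hseq` clause of ✓`exists_intertwiner_of_regPr` (iii)+(iv)):
# `Q″₁(Ad_w λ)(y) = w(embIter (K−n) y)·Q″₀(λ)(y)·w(embIter (K−n) y)⁻¹` — the `hQ`∕`hker` supplier of ✓`Prop7ProjectorGaugeCovariance.ker_eq_map_of_conj`.

Cell `ym3-torus` (HUMAN RULING D-0037, YM ladder rung R3 — NOT d = 4, NOT infinite volume, NOT a mass gap, NOT Clay).  Width seat `ym-routeR-w3` gen 12; ★p1 g24
LOCATE-L6-ASSEMBLY §1 Step I.2 (L5″), road (α) 2026-08-29 23:17:20Z («every covariance identity (`Δ^η`, `D`, `Q″`) is exact on the whole torus»).  THEOREMS ONLY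
(0 `def`, 0 `sorry`); `--supports stmt-QuantumFields-19200 --as helper`, count-neutral.  HONEST LABEL (★★OWNER RULING №33 (6)): curved γ-row supplier line (LOD
localisation), pen (L5″); pure algebra of the averaging recursion (3.19) — ✓`Prop7NestedMeanTowerCloseness.holT_tower_conj_eq` (the tower holonomy along a staircase of the
gauged field is the conjugated holonomy, [Balaban1985Averaging] (11)) + ✓`Prop7NSIntertwinerOfRecord.avgSeq_unique` (the recursion is deterministic); nothing of (3.49),
Thm 3.1∕3.3, `h349`, `hGF`, EX ∕ 19200 is proved here.  Companions: ✓`Prop7LocalDivergenceComparison` §3 (px12 g13: `D*` covariant), px12 g13's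
`…LocalLaplacianGaugeCovariance` (`D`, `Δ^η`, the `Ad_σ` isometries), ✓`Prop7ProjectorGaugeCovariance` (abstract `projR` covariance).

THE PROOF.  Let `ns` be an averaging sequence of `λ` at `U₀` ((3.19): `ns₀ = λ`, `ns_{j+1}(y) = ns_j(ŷ) − mean_i[ns_j(ŷ) − T·ns_j(x_i)·T⁻¹]`, `T = Ū₀⁽ʲ⁾(Γ_{y,i})`,
`x_i = ŷ + disp Γ_{y,i} = blockSite y i`).  Put `ns′_j(z) := w(embIter j z)·ns_j(z)·w(embIter j z)⁻¹`.  By (11) iterated (`holT_tower_conj_eq`) the transports of `U₁♭ = (U₀♭)^w`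
are `T′ = w(embIter (j+1) y)·T·w(embIter j x_i)⁻¹`, so `T′·ns′_j(x_i)·T′⁻¹ = w(ŷ′)·T ns_j(x_i) T⁻¹·w(ŷ′)⁻¹` with `ŷ′ = embIter (j+1) y = embIter j ŷ`, and the mean is linear: `ns′`
is an averaging sequence of `Ad_wλ` at `U₁`.  By uniqueness of averaging sequences (`avgSeq_unique`) it is THE one `hseq₁` provides, whose top is `Q″₁(Ad_wλ)`.

WHAT IS PROVED (ns `Summit.QuantumFields.YangMills.Theorems.Prop7TopMeanGaugeCovariance`).
* §1 `meanCLM_conj` (the index mean commutes with a fixed conjugation), `conj_recursion_term` (the conjugated recursion term).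
* §2 ★★★ `topMean_conj_of_bgUnits_eq` — the covariance for an ABSTRACT units-valued gauge `w` with `U₁♭ = (U₀♭)^w`; ★★ `avgSeq_conj` (every level `j`).
* §3 `bgUnits_gaugeAct_of_val_eq` — at the member `(U₀^σ)♭ = (U₀♭)^{w_σ}`, `w_σ x = toUnits(σ x)` for an `SU(2)` gauge transformation `σ` (`GaugeField.gaugeAct`), and
  ★★★ `topMean_gaugeAct_conj` — `Q″_{U₀^σ}(toL2S(σλσ*))(y) = σ(embIter (K−n) y)·Q″_{U₀}(toL2S λ)(y)·σ(embIter (K−n) y)*`.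

References: T. Bałaban, CMP **98** (1985) 17–51 [Balaban1985Averaging] ((8)–(11) pp.18–19, (97) p.32); CMP **99** (1985) 389–434 [Balaban1985BackgroundPropagators]
((3.19) p.393, p.393 «all the operators … are covariant with respect to gauge transformations», (3.114)–(3.115) p.418).
-/

set_option autoImplicit false

noncomputable section

open scoped BigOperators Matrix.Norms.L2Operator

namespace Summit.QuantumFields.YangMills.Theorems.Prop7TopMeanGaugeCovariance

open Literature.MathematicalPhysics.QuantumFieldTheory.Balaban1983to89
open Literature.MathematicalPhysics.QuantumFieldTheory.Balaban1983to89.T3ContinuumYM3Torus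
open T4Continuum BlockAveraging
open BlockAveraging (Idx)
open B7Prop1Explicit (disp)
open B10Eq27TorusAxialLog (holT transl gaugeActT gaugeActT_apply unitsField toUField)
open B7TransferAnalyticMean (meanCLM meanCLM_apply)
open B15DeterminingSets (embIter)
open B11Eq103H1Complex (SiteL2K)
open Summit.QuantumFields.YangMills.Theorems.Prop8Chart (emlIterU)
open T3SectALandauChart (bgUnits)
open Summit.QuantumFields.YangMills.Theorems.Prop7SectET3Transport (periodsT3)
open Summit.QuantumFields.YangMills.Theorems.Prop7SectET3HilbertLetters (W₂ toL2S)
open Summit.QuantumFields.YangMills.Theorems.Prop7NestedMeanTowerCloseness (holT_tower_conj_eq)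
open Summit.QuantumFields.YangMills.Theorems.Prop7NSIntertwinerOfRecord (avgSeq_unique)
open Summit.QuantumFields.YangMills.Theorems.Prop7BlockMeanContraction (transl_emb_disp_stairWord_eq_blockSite)

/-! ## §1 Conjugation commutes with the index mean and with the recursion term -/

section Algebra

variable {P : Params} {𝔸 : Type*} [NormedRing 𝔸] [NormedAlgebra ℂ 𝔸]

/-- The index mean is linear: `mean_i (a·f_i·b) = a·(mean_i f_i)·b`. [cite: Balaban1985BackgroundPropagators, (3.19) p.393] -/
theorem meanCLM_conj (a b : 𝔸) (f : Idx P → 𝔸) : meanCLM (Idx P) 𝔸 (fun i => a * f i * b) = a * meanCLM (Idx P) 𝔸 f * b := by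
  rw [meanCLM_apply, meanCLM_apply, mul_smul_comm, smul_mul_assoc, Finset.mul_sum, Finset.sum_mul]

omit [NormedAlgebra ℂ 𝔸] in
/-- The conjugated recursion term: with `T′ = a·T·c⁻¹` and `n′ = c·n·c⁻¹`, `T′·n′·T′⁻¹ = a·(T·n·T⁻¹)·a⁻¹` (units of a ring). [cite: Balaban1985Averaging, (11) p.19] -/
theorem conj_recursion_term (a c T : 𝔸ˣ) (nv : 𝔸) :
    ((a * T * c⁻¹ : 𝔸ˣ) : 𝔸) * ((c : 𝔸) * nv * ((c⁻¹ : 𝔸ˣ) : 𝔸)) * (((a * T * c⁻¹)⁻¹ : 𝔸ˣ) : 𝔸)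
      = (a : 𝔸) * (((T : 𝔸ˣ) : 𝔸) * nv * ((T⁻¹ : 𝔸ˣ) : 𝔸)) * ((a⁻¹ : 𝔸ˣ) : 𝔸) := by
  simp only [mul_inv_rev, inv_inv, Units.val_mul, mul_assoc, Units.inv_mul_cancel_left]

end Algebra

/-! ## §2 Covariance of the averaging sequences and of the top mean, for an abstract units-valued gauge -/

section Member

variable (F : T3Family) {n K : ℕ} {c₀ : ℝ}
  (U₀ U₁ : GaugeField (F.P K) 0 (Matrix.specialUnitaryGroup (Fin 2) ℂ))
  (w : GaugeTransf (F.P K) 0 (Matrix (Fin 2) (Fin 2) ℂ)ˣ) (hw : bgUnits F K U₁ = gaugeActT w (bgUnits F K U₀))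

include hw in
/-- ★★ **CONJUGATED AVERAGING SEQUENCES**: if `ns` is an averaging sequence at `U₀` ((3.19) with the transports of `U₀♭`), then `z ↦ w(embIter j z)·ns_j(z)·w(embIter j z)⁻¹`
is an averaging sequence at `U₁` (transports of `U₁♭ = (U₀♭)^w`), level by level. [cite: Balaban1985Averaging, (11) p.19, (97) p.32; Balaban1985BackgroundPropagators, (3.19) p.393] -/
theorem avgSeq_conj (ns : (j : ℕ) → Site (F.P K) j → Matrix (Fin 2) (Fin 2) ℂ)
    (hns : ∀ (j : ℕ) (y : Site (F.P K) (j + 1)), ns (j + 1) y = ns j (emb y) - meanCLM (Idx (F.P K)) (Matrix (Fin 2) (Fin 2) ℂ) fun i : Idx (F.P K) =>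
      ns j (emb y) - ((holT (emlIterU j (bgUnits F K U₀)) (emb y) (stairWord i.2.1 (off i.1)) : (Matrix (Fin 2) (Fin 2) ℂ)ˣ) : Matrix (Fin 2) (Fin 2) ℂ) *
        ns j (transl (emb y) (disp (stairWord i.2.1 (off i.1)))) * (((holT (emlIterU j (bgUnits F K U₀)) (emb y) (stairWord i.2.1 (off i.1)))⁻¹ : (Matrix (Fin 2) (Fin 2) ℂ)ˣ) : Matrix (Fin 2) (Fin 2) ℂ))
    (j : ℕ) (y : Site (F.P K) (j + 1)) :
    (fun (j : ℕ) (z : Site (F.P K) j) => ((w (embIter j z) : (Matrix (Fin 2) (Fin 2) ℂ)ˣ) : Matrix (Fin 2) (Fin 2) ℂ) * ns j z * (((w (embIter j z))⁻¹ : (Matrix (Fin 2) (Fin 2) ℂ)ˣ) : Matrix (Fin 2) (Fin 2) ℂ)) (j + 1) y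
      = (fun (j : ℕ) (z : Site (F.P K) j) => ((w (embIter j z) : (Matrix (Fin 2) (Fin 2) ℂ)ˣ) : Matrix (Fin 2) (Fin 2) ℂ) * ns j z * (((w (embIter j z))⁻¹ : (Matrix (Fin 2) (Fin 2) ℂ)ˣ) : Matrix (Fin 2) (Fin 2) ℂ)) j (emb y)
        - meanCLM (Idx (F.P K)) (Matrix (Fin 2) (Fin 2) ℂ) fun i : Idx (F.P K) =>
          (fun (j : ℕ) (z : Site (F.P K) j) => ((w (embIter j z) : (Matrix (Fin 2) (Fin 2) ℂ)ˣ) : Matrix (Fin 2) (Fin 2) ℂ) * ns j z * (((w (embIter j z))⁻¹ : (Matrix (Fin 2) (Fin 2) ℂ)ˣ) : Matrix (Fin 2) (Fin 2) ℂ)) j (emb y)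
          - ((holT (emlIterU j (bgUnits F K U₁)) (emb y) (stairWord i.2.1 (off i.1)) : (Matrix (Fin 2) (Fin 2) ℂ)ˣ) : Matrix (Fin 2) (Fin 2) ℂ) *
            (fun (j : ℕ) (z : Site (F.P K) j) => ((w (embIter j z) : (Matrix (Fin 2) (Fin 2) ℂ)ˣ) : Matrix (Fin 2) (Fin 2) ℂ) * ns j z * (((w (embIter j z))⁻¹ : (Matrix (Fin 2) (Fin 2) ℂ)ˣ) : Matrix (Fin 2) (Fin 2) ℂ)) j (transl (emb y) (disp (stairWord i.2.1 (off i.1))))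
            * (((holT (emlIterU j (bgUnits F K U₁)) (emb y) (stairWord i.2.1 (off i.1)))⁻¹ : (Matrix (Fin 2) (Fin 2) ℂ)ˣ) : Matrix (Fin 2) (Fin 2) ℂ) := by
  -- the transports of `U₁♭ = (U₀♭)^w` along the staircases are the conjugated transports of `U₀♭`
  have hT : ∀ i : Idx (F.P K), holT (emlIterU j (bgUnits F K U₁)) (emb y) (stairWord i.2.1 (off i.1))
      = w (embIter (j + 1) y) * holT (emlIterU j (bgUnits F K U₀)) (emb y) (stairWord i.2.1 (off i.1)) * (w (embIter j (Site.blockSite y i.1)))⁻¹ := by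
    intro i
    rw [hw, ← holT_tower_conj_eq]
  simp only [hT, transl_emb_disp_stairWord_eq_blockSite]
  -- `embIter (j+1) y = embIter j (emb y)` by definition
  have hemb : embIter (j + 1) y = embIter j (emb y) := rfl
  rw [hns j y]
  simp only [transl_emb_disp_stairWord_eq_blockSite, conj_recursion_term, hemb]
  rw [mul_sub, sub_mul, ← meanCLM_conj]
  congr 2
  funext i
  rw [mul_sub, sub_mul]

include hw in
/-- ★★★ **THE TOP NESTED COVARIANT MEAN OF RECORD IS GAUGE COVARIANT** (abstract units-valued gauge `w`, `U₁♭ = (U₀♭)^w`): for ANY `Q″₀` satisfying the averaging-of-record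
clause `hseq` at `U₀` and ANY `Q″₁` satisfying it at `U₁` (clauses (iii)+(iv) of ✓`exists_intertwiner_of_regPr`, VERBATIM as in ✓`Prop7MassivePropagatorCoercive`),
`Q″₁(toL2S (w·λ·w⁻¹))(y) = w(embIter (K−n) y)·Q″₀(toL2S λ)(y)·w(embIter (K−n) y)⁻¹` — the coarse intertwiner `Θ_w = Ad_{w∘embIter (K−n)}` of
✓`Prop7ProjectorGaugeCovariance.ker_eq_map_of_conj`. [cite: Balaban1985Averaging, (11) p.19, (97) p.32; Balaban1985BackgroundPropagators, (3.19) p.393, (3.114)–(3.115) p.418] -/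
theorem topMean_conj_of_bgUnits_eq
    (Q₀ : SiteL2K ℂ 3 (periodsT3 F K) c₀ W₂ →ₗ[ℂ] (Site (F.P K) (K - n) → Matrix (Fin 2) (Fin 2) ℂ))
    (hseq₀ : (∀ lam : Site (F.P K) 0 → Matrix (Fin 2) (Fin 2) ℂ, ∃ ns : (j : ℕ) → Site (F.P K) j → Matrix (Fin 2) (Fin 2) ℂ, ns 0 = lam ∧
      (∀ (j : ℕ) (y : Site (F.P K) (j + 1)), ns (j + 1) y = ns j (emb y) - meanCLM (Idx (F.P K)) (Matrix (Fin 2) (Fin 2) ℂ) fun i : Idx (F.P K) =>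
        ns j (emb y) - ((holT (emlIterU j (bgUnits F K U₀)) (emb y) (stairWord i.2.1 (off i.1)) : (Matrix (Fin 2) (Fin 2) ℂ)ˣ) : Matrix (Fin 2) (Fin 2) ℂ) *
          ns j (transl (emb y) (disp (stairWord i.2.1 (off i.1)))) * (((holT (emlIterU j (bgUnits F K U₀)) (emb y) (stairWord i.2.1 (off i.1)))⁻¹ : (Matrix (Fin 2) (Fin 2) ℂ)ˣ) : Matrix (Fin 2) (Fin 2) ℂ)) ∧
      ns (K - n) = Q₀ (toL2S F K c₀ lam)))
    (Q₁ : SiteL2K ℂ 3 (periodsT3 F K) c₀ W₂ →ₗ[ℂ] (Site (F.P K) (K - n) → Matrix (Fin 2) (Fin 2) ℂ))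
    (hseq₁ : (∀ lam : Site (F.P K) 0 → Matrix (Fin 2) (Fin 2) ℂ, ∃ ns : (j : ℕ) → Site (F.P K) j → Matrix (Fin 2) (Fin 2) ℂ, ns 0 = lam ∧
      (∀ (j : ℕ) (y : Site (F.P K) (j + 1)), ns (j + 1) y = ns j (emb y) - meanCLM (Idx (F.P K)) (Matrix (Fin 2) (Fin 2) ℂ) fun i : Idx (F.P K) =>
        ns j (emb y) - ((holT (emlIterU j (bgUnits F K U₁)) (emb y) (stairWord i.2.1 (off i.1)) : (Matrix (Fin 2) (Fin 2) ℂ)ˣ) : Matrix (Fin 2) (Fin 2) ℂ) *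
          ns j (transl (emb y) (disp (stairWord i.2.1 (off i.1)))) * (((holT (emlIterU j (bgUnits F K U₁)) (emb y) (stairWord i.2.1 (off i.1)))⁻¹ : (Matrix (Fin 2) (Fin 2) ℂ)ˣ) : Matrix (Fin 2) (Fin 2) ℂ)) ∧
      ns (K - n) = Q₁ (toL2S F K c₀ lam)))
    (lam : Site (F.P K) 0 → Matrix (Fin 2) (Fin 2) ℂ) (y : Site (F.P K) (K - n)) :
    Q₁ (toL2S F K c₀ (fun x => ((w x : (Matrix (Fin 2) (Fin 2) ℂ)ˣ) : Matrix (Fin 2) (Fin 2) ℂ) * lam x * (((w x)⁻¹ : (Matrix (Fin 2) (Fin 2) ℂ)ˣ) : Matrix (Fin 2) (Fin 2) ℂ))) y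
      = ((w (embIter (K - n) y) : (Matrix (Fin 2) (Fin 2) ℂ)ˣ) : Matrix (Fin 2) (Fin 2) ℂ) * Q₀ (toL2S F K c₀ lam) y * (((w (embIter (K - n) y))⁻¹ : (Matrix (Fin 2) (Fin 2) ℂ)ˣ) : Matrix (Fin 2) (Fin 2) ℂ) := by
  obtain ⟨ns, h0, hrec, htop⟩ := hseq₀ lam
  obtain ⟨ns', h0', hrec', htop'⟩ := hseq₁ (fun x => ((w x : (Matrix (Fin 2) (Fin 2) ℂ)ˣ) : Matrix (Fin 2) (Fin 2) ℂ) * lam x * (((w x)⁻¹ : (Matrix (Fin 2) (Fin 2) ℂ)ˣ) : Matrix (Fin 2) (Fin 2) ℂ))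
  -- the conjugated sequence is an averaging sequence at `U₁` with the same start, hence equal to `ns'`
  have huniq := avgSeq_unique (fun (j : ℕ) (y : Site (F.P K) (j + 1)) (i : Idx (F.P K)) => holT (emlIterU j (bgUnits F K U₁)) (emb y) (stairWord i.2.1 (off i.1)))
    (fun (j : ℕ) (z : Site (F.P K) j) => ((w (embIter j z) : (Matrix (Fin 2) (Fin 2) ℂ)ˣ) : Matrix (Fin 2) (Fin 2) ℂ) * ns j z * (((w (embIter j z))⁻¹ : (Matrix (Fin 2) (Fin 2) ℂ)ˣ) : Matrix (Fin 2) (Fin 2) ℂ)) ns'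
    (by funext z; rw [h0', h0]; rfl) (fun j y => avgSeq_conj F U₀ U₁ w hw ns hrec j y) hrec' (K - n)
  have hy := congrFun huniq y
  rw [← htop', ← hy, htop]

end Member

/-! ## §3 At an `SU(2)` gauge transformation of the background (`GaugeField.gaugeAct`) -/

section SU2

variable (F : T3Family) {n K : ℕ} {c₀ : ℝ}

/-- **`(U₀^σ)♭ = (U₀♭)^{w}` IN UNITS** for any units-valued reading `w` of the `SU(2)` gauge transformation `σ` (`(w x : M₂) = σ x`; then `(w x)⁻¹ = σ(x)*` automatically):
`bgUnits` of `GaugeField.gaugeAct σ U₀` is `gaugeActT w (bgUnits U₀)` — both are `σ(b₋)U₀(b)σ(b₊)*` bondwise (the abstract-`w` edition of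
✓`Prop7NestedMeanParallelLiftGauge.bgUnits_gaugeAct`, which fixes `w := toUnits ∘ suIncl ∘ σ`). [cite: Balaban1985Averaging, (8) p.19, (19) p.21] -/
theorem bgUnits_gaugeAct_of_val_eq (σ : GaugeTransf (F.P K) 0 (Matrix.specialUnitaryGroup (Fin 2) ℂ)) (w : GaugeTransf (F.P K) 0 (Matrix (Fin 2) (Fin 2) ℂ)ˣ)
    (hwσ : ∀ x, ((w x : (Matrix (Fin 2) (Fin 2) ℂ)ˣ) : Matrix (Fin 2) (Fin 2) ℂ) = ((σ x : Matrix.specialUnitaryGroup (Fin 2) ℂ) : Matrix (Fin 2) (Fin 2) ℂ)) (U₀ : GaugeField (F.P K) 0 (Matrix.specialUnitaryGroup (Fin 2) ℂ)) :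
    bgUnits F K (GaugeField.gaugeAct σ U₀) = gaugeActT w (bgUnits F K U₀) := by
  funext b
  apply Units.ext
  have hwinv : ∀ x, (((w x)⁻¹ : (Matrix (Fin 2) (Fin 2) ℂ)ˣ) : Matrix (Fin 2) (Fin 2) ℂ) = star ((σ x : Matrix.specialUnitaryGroup (Fin 2) ℂ) : Matrix (Fin 2) (Fin 2) ℂ) :=
    fun x => Units.inv_eq_of_mul_eq_one_left (by rw [hwσ]; exact Matrix.mem_unitaryGroup_iff'.1 (σ x).2.1)
  rw [gaugeActT_apply, Units.val_mul, Units.val_mul, hwσ, hwinv]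
  have hinv : (((σ b.tgt)⁻¹ : Matrix.specialUnitaryGroup (Fin 2) ℂ) : Matrix (Fin 2) (Fin 2) ℂ) = star ((σ b.tgt : Matrix.specialUnitaryGroup (Fin 2) ℂ) : Matrix (Fin 2) (Fin 2) ℂ) := rfl
  show ((GaugeField.gaugeAct σ U₀ b : Matrix.specialUnitaryGroup (Fin 2) ℂ) : Matrix (Fin 2) (Fin 2) ℂ)
      = (σ b.src : Matrix (Fin 2) (Fin 2) ℂ) * ((U₀ b : Matrix.specialUnitaryGroup (Fin 2) ℂ) : Matrix (Fin 2) (Fin 2) ℂ) * star ((σ b.tgt : Matrix.specialUnitaryGroup (Fin 2) ℂ) : Matrix (Fin 2) (Fin 2) ℂ)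
  rw [← hinv]
  simp [GaugeField.gaugeAct]

/-- ★★★ **THE TOP NESTED COVARIANT MEAN OF RECORD IS GAUGE COVARIANT, `SU(2)` LETTERS**: for an `SU(2)` gauge transformation `σ`, ANY `Q″₀` with the averaging-of-record
clause at `U₀` and ANY `Q″₁` with it at `U₀^σ = GaugeField.gaugeAct σ U₀`:
`Q″₁(toL2S(x ↦ σ(x)·λ(x)·σ(x)*))(y) = σ(embIter (K−n) y)·Q″₀(toL2S λ)(y)·σ(embIter (K−n) y)*` — with ✓`Prop7ProjectorGaugeCovariance.ker_eq_map_of_conj` this is the `hker`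
of `projR_conj` at the member (`Θ_σ = Ad_{σ∘embIter (K−n)}` on the coarse sections), and with px12 g13's `Φ_σ`∕`hΔ` rows the `P`-term of Organisation I is a gauge invariant.
[cite: Balaban1985Averaging, (11) p.19, (97) p.32; Balaban1985BackgroundPropagators, (3.19) p.393, p.393, (3.114)–(3.115) p.418] -/
theorem topMean_gaugeAct_conj (σ : GaugeTransf (F.P K) 0 (Matrix.specialUnitaryGroup (Fin 2) ℂ)) (U₀ : GaugeField (F.P K) 0 (Matrix.specialUnitaryGroup (Fin 2) ℂ))
    (Q₀ : SiteL2K ℂ 3 (periodsT3 F K) c₀ W₂ →ₗ[ℂ] (Site (F.P K) (K - n) → Matrix (Fin 2) (Fin 2) ℂ))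
    (hseq₀ : (∀ lam : Site (F.P K) 0 → Matrix (Fin 2) (Fin 2) ℂ, ∃ ns : (j : ℕ) → Site (F.P K) j → Matrix (Fin 2) (Fin 2) ℂ, ns 0 = lam ∧
      (∀ (j : ℕ) (y : Site (F.P K) (j + 1)), ns (j + 1) y = ns j (emb y) - meanCLM (Idx (F.P K)) (Matrix (Fin 2) (Fin 2) ℂ) fun i : Idx (F.P K) =>
        ns j (emb y) - ((holT (emlIterU j (bgUnits F K U₀)) (emb y) (stairWord i.2.1 (off i.1)) : (Matrix (Fin 2) (Fin 2) ℂ)ˣ) : Matrix (Fin 2) (Fin 2) ℂ) *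
          ns j (transl (emb y) (disp (stairWord i.2.1 (off i.1)))) * (((holT (emlIterU j (bgUnits F K U₀)) (emb y) (stairWord i.2.1 (off i.1)))⁻¹ : (Matrix (Fin 2) (Fin 2) ℂ)ˣ) : Matrix (Fin 2) (Fin 2) ℂ)) ∧
      ns (K - n) = Q₀ (toL2S F K c₀ lam)))
    (Q₁ : SiteL2K ℂ 3 (periodsT3 F K) c₀ W₂ →ₗ[ℂ] (Site (F.P K) (K - n) → Matrix (Fin 2) (Fin 2) ℂ))
    (hseq₁ : (∀ lam : Site (F.P K) 0 → Matrix (Fin 2) (Fin 2) ℂ, ∃ ns : (j : ℕ) → Site (F.P K) j → Matrix (Fin 2) (Fin 2) ℂ, ns 0 = lam ∧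
      (∀ (j : ℕ) (y : Site (F.P K) (j + 1)), ns (j + 1) y = ns j (emb y) - meanCLM (Idx (F.P K)) (Matrix (Fin 2) (Fin 2) ℂ) fun i : Idx (F.P K) =>
        ns j (emb y) - ((holT (emlIterU j (bgUnits F K (GaugeField.gaugeAct σ U₀))) (emb y) (stairWord i.2.1 (off i.1)) : (Matrix (Fin 2) (Fin 2) ℂ)ˣ) : Matrix (Fin 2) (Fin 2) ℂ) *
          ns j (transl (emb y) (disp (stairWord i.2.1 (off i.1)))) * (((holT (emlIterU j (bgUnits F K (GaugeField.gaugeAct σ U₀))) (emb y) (stairWord i.2.1 (off i.1)))⁻¹ : (Matrix (Fin 2) (Fin 2) ℂ)ˣ) : Matrix (Fin 2) (Fin 2) ℂ)) ∧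
      ns (K - n) = Q₁ (toL2S F K c₀ lam)))
    (lam : Site (F.P K) 0 → Matrix (Fin 2) (Fin 2) ℂ) (y : Site (F.P K) (K - n)) :
    Q₁ (toL2S F K c₀ (fun x => ((σ x : Matrix.specialUnitaryGroup (Fin 2) ℂ) : Matrix (Fin 2) (Fin 2) ℂ) * lam x * star ((σ x : Matrix.specialUnitaryGroup (Fin 2) ℂ) : Matrix (Fin 2) (Fin 2) ℂ))) y
      = ((σ (embIter (K - n) y) : Matrix.specialUnitaryGroup (Fin 2) ℂ) : Matrix (Fin 2) (Fin 2) ℂ) * Q₀ (toL2S F K c₀ lam) y * star ((σ (embIter (K - n) y) : Matrix.specialUnitaryGroup (Fin 2) ℂ) : Matrix (Fin 2) (Fin 2) ℂ) := by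
  let w : GaugeTransf (F.P K) 0 (Matrix (Fin 2) (Fin 2) ℂ)ˣ := fun x =>
    ⟨((σ x : Matrix.specialUnitaryGroup (Fin 2) ℂ) : Matrix (Fin 2) (Fin 2) ℂ), star ((σ x : Matrix.specialUnitaryGroup (Fin 2) ℂ) : Matrix (Fin 2) (Fin 2) ℂ), Matrix.mem_unitaryGroup_iff.1 (σ x).2.1, Matrix.mem_unitaryGroup_iff'.1 (σ x).2.1⟩
  have hw : bgUnits F K (GaugeField.gaugeAct σ U₀) = gaugeActT w (bgUnits F K U₀) := bgUnits_gaugeAct_of_val_eq F σ w (fun _ => rfl) U₀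
  exact topMean_conj_of_bgUnits_eq F U₀ (GaugeField.gaugeAct σ U₀) w hw Q₀ hseq₀ Q₁ hseq₁ lam y

end SU2

end Summit.QuantumFields.YangMills.Theorems.Prop7TopMeanGaugeCovariance

end
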